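import Mathlib
import Summits.Ventures.PercRepro2.LocRows
import Summits.Ventures.PercRepro2.SwRow
import Summits.Ventures.PercRepro2.SwOut
import Summits.Ventures.PercRepro2.SwAllRow
import Summits.Ventures.PercRepro2.SwOutAll
import Summits.Ventures.PercRepro2.SwOutArmFlip
import Summits.Ventures.PercRepro2.SwOutArmThm
import Summits.Ventures.PercRepro2.SwOutReducible
import Summits.Ventures.PercRepro2.SwOutBridge

/-!
# The closure of the core-free criteria: vertices that are never a core (blind cell PercRepro2,
night-4 g28, 2026-08-28; proofs/NIGHT4-G28.md §8)

`NeverCore ends U h o x` is the inductive closure of the reasons why a vertex `x ≠ h` of the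
region is never a core (a vertex of both clusters of `h`) at a `Q`-point of a class: `x` carries
an outside edge (`out`), or no edge (`iso`), or `x` is the mark (`mark`: `o ∉ C_R(h)` on `Q`), or
`x` is separated from `h` by one EDGE of `G[U]` (`edge`, SwOutBridge), or `x` is separated from
`h` by one VERTEX `w ≠ x, h` that is itself never a core (`vertex`: a red and a blue path from `h`
to `x` both pass through `w`, which would be a core).  **`NeverCore.not_core`** (induction on the
closure), **`coreFree_of_neverCore`**, **`rigidOK_of_neverCore`**, `reducible_of_neverCore`,
**`swAll_of_neverCore`**, **`sw_of_neverCore`**: a region all of whose vertices other than `h, o`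
are `NeverCore` is a base region of the series reduction — the bridge junctions (`rigidOK_of_bridges`)
are the closure without `mark` and `vertex`.  Separation by a vertex is the block-cut-tree form of
the criterion (the vertex `w` a cut vertex of `G[U]` between `h` and `x`, carrying an outside edge,
or the mark, or itself behind such a vertex).
-/

namespace Summit.Ventures.PercRepro2

namespace LocRows

open Hull

variable {V : Type*} {E : Type*} [Fintype E] [DecidableEq E]

open scoped Classical

variable {ends : E → Sym2 V}

section Avoid

variable (ends) (U : Set V) (w : V)

/-- The all-open colouring of the edges inside `U ∖ {w}`: `G[U] − w`. -/
noncomputable def avoidConfig : Config E :=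
  fun e => decide (e ∈ within ends (U \ {w}))

variable {ends U w}

omit [Fintype E] [DecidableEq E] in
/-- An edge is open in `G[U] − w` iff it lies inside `U ∖ {w}`. -/
lemma avoidConfig_eq_true_iff {e : E} :
    avoidConfig ends U w e = true ↔ e ∈ within ends (U \ {w}) := by
  simp [avoidConfig]

omit [Fintype E] [DecidableEq E] in
/-- **A cluster of `h` inside `U` avoiding the vertex `w` lies in the cluster of `h` in
`G[U] − w`**. -/
theorem cluster_subset_cluster_avoid {ζ : Config E} {h : V} (hT : cluster ends ζ h ⊆ U)
    (hw : w ∉ cluster ends ζ h) : cluster ends ζ h ⊆ cluster ends (avoidConfig ends U w) h := by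
  intro x hx
  have key : cluster ends ζ h ⊆
      {y | y ∈ cluster ends ζ h ∧ y ∈ cluster ends (avoidConfig ends U w) h} := by
    intro y hy
    refine mem_of_conn_of_closed (ends := ends) (ω := ζ) ?_
      ⟨mem_cluster_self _ _ _, mem_cluster_self _ _ _⟩ hy
    rintro a ⟨haT, haC⟩ b hab
    have hbT : b ∈ cluster ends ζ h := mem_cluster_of_adj haT hab
    refine ⟨hbT, ?_⟩
    obtain ⟨_, e, _, hends⟩ := openGraph_adj.1 hab
    refine mem_cluster_of_edge (ends := ends) haC (e := e) ?_ hends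
    rw [avoidConfig_eq_true_iff]
    refine ⟨a, ⟨hT haT, ?_⟩, b, ⟨hT hbT, ?_⟩, hends⟩
    · rintro rfl; exact hw haT
    · rintro rfl; exact hw hbT
  exact (key hx).2

omit [Fintype E] [DecidableEq E] in
/-- The cluster of `h` in `G[U] − w` lies in any set containing `h` and closed under the edges
inside `U ∖ {w}` (for instances). -/
lemma cluster_avoid_subset {h : V} {S : Set V} (hh : h ∈ S)
    (hS : ∀ e x y, ends e = s(x, y) → e ∈ within ends (U \ {w}) → x ∈ S → y ∈ S) :
    cluster ends (avoidConfig ends U w) h ⊆ S := by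
  intro v hv
  refine mem_of_conn_of_closed (ends := ends) (S := S) ?_ hh hv
  intro a ha b hab
  obtain ⟨_, e, he, hends⟩ := openGraph_adj.1 hab
  rw [avoidConfig_eq_true_iff] at he
  exact hS e a b hends he ha

end Avoid

section NeverCore

variable (ends) (U : Set V) (h o : V)

/-- **The vertices that are never a core**: the closure of «an outside edge», «no edge», «the
mark», «separated from `h` by one edge of `G[U]`» under «separated from `h` by one vertex `w ≠ x, h`
that is never a core». -/
inductive NeverCore : V → Prop
  | out (x : V) (e : E) (y : V) (hxy : ends e = s(x, y)) (hy : y ∉ U) : NeverCore x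
  | iso (x : V) (hx : ∀ e, x ∉ ends e) : NeverCore x
  | mark : NeverCore o
  | edge (x : V) (e₀ : E) (hx : x ∉ cluster ends (cutConfig ends U e₀) h) : NeverCore x
  | vertex (x w : V) (hw : NeverCore w) (hwx : w ≠ x) (hwh : w ≠ h)
      (hx : x ∉ cluster ends (avoidConfig ends U w) h) : NeverCore x

variable {ends U h o}

variable {l : V} {ξ : Config E}

/-- **A `NeverCore` vertex other than `h` is in both clusters of `h` at no `Q`-point of the
class.** -/
theorem NeverCore.not_core {x : V} (hN : NeverCore ends U h o x) (hxh : x ≠ h) {ζ : Config E}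
    (hζ : ζ ∈ swOutSide ends l h o U ξ) (hxT : x ∈ cluster ends ζ h)
    (hxTp : x ∈ cluster ends (blue ζ) h) : False := by
  have hQ := (mem_swOutSide.1 hζ).1
  have hcl := (mem_swOutSide.1 hζ).2
  have hT : cluster ends ζ h ⊆ U := fun y hy => (mem_outClass.1 hcl).2 (Or.inl hy)
  have hTp : cluster ends (blue ζ) h ⊆ U := fun y hy => (mem_outClass.1 hcl).2 (Or.inr hy)
  induction hN with
  | out x e y hxy hyU =>
    cases he : ζ e with
    | true => exact hyU (hT (mem_cluster_of_edge hxT he hxy))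
    | false =>
      have he' : blue ζ e = true := by rw [blue_eq_true_iff]; exact he
      exact hyU (hTp (mem_cluster_of_edge hxTp he' hxy))
  | iso x hiso =>
    obtain ⟨e, hxe⟩ := exists_edge_of_mem_cluster hxT hxh
    exact hiso e hxe
  | mark =>
    simp only [tgtU, Finset.mem_filter, Finset.mem_univ, true_and, Set.mem_setOf_eq, hull,
      Set.mem_union, not_or] at hQ
    obtain ⟨⟨hhA, _⟩, hoA, _⟩ := hQ
    exact hhA (conn_trans hoA (conn_symm hxT))
  | edge x e₀ hx => exact not_core_of_cut (mem_outClass.1 hcl).2 hx hxT hxTp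
  | vertex x w _ hwx hwh hx ih =>
    -- `w` lies on every red and on every blue path from `h` to `x`
    have hwT : w ∈ cluster ends ζ h := by
      by_contra hw
      exact hx (cluster_subset_cluster_avoid hT hw hxT)
    have hwTp : w ∈ cluster ends (blue ζ) h := by
      by_contra hw
      exact hx (cluster_subset_cluster_avoid hTp hw hxTp)
    exact ih hwh hwT hwTp

/-- **Every `Q`-point of the class is core-free** when every vertex of `U ∖ {h, o}` is `NeverCore`. -/
theorem coreFree_of_neverCore (hN : ∀ x ∈ U, x ≠ h → x ≠ o → NeverCore ends U h o x)
    {ζ : Config E} (hζ : ζ ∈ swOutSide ends l h o U ξ) : CoreFree ends ζ h := by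
  intro x hxT hxTp
  by_contra hxh
  have hcl := (mem_swOutSide.1 hζ).2
  have hxU : x ∈ U := (mem_outClass.1 hcl).2 (Or.inl hxT)
  by_cases hxo : x = o
  · subst hxo
    exact NeverCore.mark.not_core hxh hζ hxT hxTp
  · exact (hN x hxU hxh hxo).not_core hxh hζ hxT hxTp

/-- **The rigid inequality on every class of a region whose vertices other than `h, o` are
`NeverCore`** (no loop at `h`): the arm principle on a core-free class. -/
theorem rigidOK_of_neverCore (hl : l ∉ U) (hloop : ∀ e, ends e ≠ s(h, h))
    (hN : ∀ x ∈ U, x ≠ h → x ≠ o → NeverCore ends U h o x) (ξ : Config E) :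
    RigidOK ends l h o U ξ :=
  fun _ h𝓔 => rigidOK_of_coreFree hl hloop (fun _ hζ => coreFree_of_neverCore hN hζ) h𝓔

/-- A region whose vertices other than `h, o` are `NeverCore` is a base region of the series
reduction. -/
theorem reducible_of_neverCore (hl : l ∉ U) (hloop : ∀ e, ends e ≠ s(h, h))
    (hN : ∀ x ∈ U, x ≠ h → x ≠ o → NeverCore ends U h o x) : Reducible l h o ends U :=
  Reducible.base ends U fun ξ => rigidOK_of_neverCore hl hloop hN ξ

omit [Fintype E] in
/-- The bridge hypothesis gives `NeverCore` (the closure without `mark` and `vertex`). -/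
theorem neverCore_of_bridges
    (hbr : ∀ x ∈ U, x ≠ h → x ≠ o →
      (∃ e y, ends e = s(x, y) ∧ y ∉ U) ∨ (∀ e, x ∉ ends e) ∨
        ∃ e₀, x ∉ cluster ends (cutConfig ends U e₀) h) :
    ∀ x ∈ U, x ≠ h → x ≠ o → NeverCore ends U h o x := by
  intro x hxU hxh hxo
  rcases hbr x hxU hxh hxo with ⟨e, y, hxy, hyU⟩ | hiso | ⟨e₀, hx⟩
  · exact NeverCore.out x e y hxy hyU
  · exact NeverCore.iso x hiso
  · exact NeverCore.edge x e₀ hx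

end NeverCore

section Rows

variable {l h o : V}

/-- **Row 2′SW-ALL on every graph whose vertices other than `l, h, o` are `NeverCore` in the region
`{l}ᶜ`** (no loop at `h`). -/
theorem swAll_of_neverCore (hlh : l ≠ h) (hloop : ∀ e, ends e ≠ s(h, h))
    (hN : ∀ x, x ≠ l → x ≠ h → x ≠ o → NeverCore ends ({l}ᶜ) h o x) : SwAll ends l h o :=
  swAll_of_reducible l h o hlh (reducible_of_neverCore (by simp) hloop
    fun x hx hxh hxo => hN x (by simpa using hx) hxh hxo)

/-- **Row (SW) on every graph whose vertices other than `l, h, o` are `NeverCore`** (see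
`swAll_of_neverCore`). -/
theorem sw_of_neverCore (hlh : l ≠ h) (hloop : ∀ e, ends e ≠ s(h, h))
    (hN : ∀ x, x ≠ l → x ≠ h → x ≠ o → NeverCore ends ({l}ᶜ) h o x) : Sw ends l h o :=
  sw_of_swAll ends (swAll_of_neverCore hlh hloop hN)

end Rows

end LocRows

end Summit.Ventures.PercRepro2
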